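import Mathlib
import Literature.Analysis.FluidPDE.VectorCalculus
import Summits.NavierStokesRegularity.NavierStokesRegularity.Theorems.FilamentSkeletonRssSelectionBoxRJRungPartnerStrain

/-!
# Route `FilamentSkeletonRss` · crux `SelectionBoxRJ` (stmt-NavierStokesRegularity-21220) — census:
# the skeleton field is divergence-free, `tr Dv = 3/2`, and the trace inequality of clause 12 is implied

Lane `ns-filament-19175-p1` (g6).  Helper file `--supports stmt-NavierStokesRegularity-21220`; route-independent.  Completes the
census add-on of `…RungSlipLaw` (`box_eigenvector_law`: at the stagnation point the tangent is an exact eigenvector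
of `A = Dv(X(c))` with eigenvalue `w′(c)`):

* `biotSavart_sum_inner_fderiv_eq_zero` — the regularised Biot–Savart field
  `F(y) = ∫ K₃(y − X u) • X′(u) × (y − X u) du` of a `C¹` filament with `‖X′‖ ≤ 1` and linear growth is
  DIVERGENCE-FREE in the kernel's own terms: `Σᵢ ⟪bᵢ, DF(y) bᵢ⟫ = 0` for every orthonormal basis `b` of `ℝ³`
  (the explicit derivative integrand of `stub_biotSavartDirectionalDeriv` — now known to be `DF(y)v`,
  `biotSavart_fderiv_apply_eq` — has pointwise trace `−3K₅⟪w, T × w⟫ + K₃ Σᵢ⟪bᵢ, T × bᵢ⟫ = 0`).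
* `skeletonField_trace_eq` — hence for the box's frame velocity `v = Σₖ cₖ Fₖ + ½ id − α e₃ × ·`
  (hypotheses `hu`, `hv` of `SelectionBoxRJ` / `TransverseReductionRJ`, any coefficients):
  `Σᵢ ⟪bᵢ, Dv(x) bᵢ⟫ = 3/2` for every orthonormal basis.
* `normalBlock_trace_eq` — with an orthonormal frame `(t, m, n)` (clause 12) and the eigenvector law
  `Dv(x) t = λ t`: `⟪Dv(x) m, m⟫ + ⟪Dv(x) n, n⟫ = 3/2 − λ`.  At the stagnation point `λ = w′(c) ≥ 3/2 + δ`
  (clause 11), so the trace half of clause 12, `⟪A m, m⟫ + ⟪A n, n⟫ < 0`, is IMPLIED by clauses 2, 5, 6, 7, 11 (for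
  `Γ` with the waist inside the tangency ball): `normalBlock_trace_neg`.  Clause 12 therefore only carries the
  determinant condition (census item for the planner's next retype; no route edit implied).

HONEST FRAMING.  Bookkeeping about a HYPOTHETICAL filament box; nothing here is a claim about Navier–Stokes
regularity or blow-up.
-/

set_option linter.dupNamespace false

noncomputable section

namespace Summit.NavierStokesRegularity.NavierStokesRegularity.Theorems

open Set Function Filter MeasureTheory Real
open Literature.Analysis.FluidPDE
open Summit.NavierStokesRegularity.NavierStokesRegularity.Theorems.SkeletonEquilibrium.Sketch
open scoped InnerProductSpace Topology

namespace SelectionBoxRJRung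

/-- Pointwise trace of the derivative integrand: for any orthonormal basis `b` of `ℝ³`,
`Σᵢ ⟪bᵢ, (a ⟪w, bᵢ⟫) • T × w + K • T × bᵢ⟫ = 0` (`Σᵢ ⟪w, bᵢ⟫⟪bᵢ, T × w⟫ = ⟪w, T × w⟫ = 0` by Parseval, and
`⟪bᵢ, T × bᵢ⟫ = 0`). [folklore] -/
theorem sum_inner_gradIntegrand_eq_zero {ι : Type*} [Fintype ι]
    (b : OrthonormalBasis ι ℝ (EuclideanSpace ℝ (Fin 3))) (a K : ℝ) (T w : EuclideanSpace ℝ (Fin 3)) :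
    ∑ i, ⟪b i, (a * ⟪w, b i⟫_ℝ) • cross T w + K • cross T (b i)⟫_ℝ = 0 := by
  have hperp : ∀ c d : EuclideanSpace ℝ (Fin 3), ⟪cross c d, d⟫_ℝ = 0 := fun c d => by
    simp [cross, crossProduct, PiLp.inner_apply, Fin.sum_univ_three]; ring
  have h1 : ∀ i, ⟪b i, (a * ⟪w, b i⟫_ℝ) • cross T w + K • cross T (b i)⟫_ℝ =
      a * (⟪w, b i⟫_ℝ * ⟪b i, cross T w⟫_ℝ) := by
    intro i
    rw [inner_add_right, real_inner_smul_right, real_inner_smul_right, real_inner_comm (cross T (b i)) (b i),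
      hperp, mul_zero, add_zero]
    ring
  simp_rw [h1]
  rw [← Finset.mul_sum, b.sum_inner_mul_inner, real_inner_comm (cross T w) w, hperp, mul_zero]

/-- **The regularised Biot–Savart field of a filament is divergence-free** (trace form): under the hypotheses of
`stub_biotSavartDirectionalDeriv` (`e ≠ 0`, `C¹` filament, `‖X′‖ ≤ 1`, linear growth `c₀|u| − C ≤ ‖X u‖`), for every
point `y` and every orthonormal basis `b` of `ℝ³`, `Σᵢ ⟪bᵢ, (fderiv F y) bᵢ⟫ = 0`. [folklore] -/
theorem biotSavart_sum_inner_fderiv_eq_zero {ι : Type*} [Fintype ι] {e c₀ C : ℝ}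
    {X : ℝ → EuclideanSpace ℝ (Fin 3)} (he : e ≠ 0) (hc₀ : 0 < c₀) (hX : ContDiff ℝ 1 X)
    (hdX : ∀ u, ‖deriv X u‖ ≤ 1) (hgrow : ∀ u, c₀ * |u| - C ≤ ‖X u‖)
    (b : OrthonormalBasis ι ℝ (EuclideanSpace ℝ (Fin 3))) (y : EuclideanSpace ℝ (Fin 3)) :
    ∑ i, ⟪b i, fderiv ℝ (fun y : EuclideanSpace ℝ (Fin 3) => ∫ u : ℝ,
        ((‖y - X u‖ ^ 2 + e ^ 2) ^ (3 / 2 : ℝ))⁻¹ • cross (deriv X u) (y - X u)) y (b i)⟫_ℝ = 0 := by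
  -- each directional derivative is the explicit integral
  have happ : ∀ i, fderiv ℝ (fun y : EuclideanSpace ℝ (Fin 3) => ∫ u : ℝ,
        ((‖y - X u‖ ^ 2 + e ^ 2) ^ (3 / 2 : ℝ))⁻¹ • cross (deriv X u) (y - X u)) y (b i) =
      ∫ u : ℝ, ((-3 * ⟪y - X u, b i⟫_ℝ * ((‖y - X u‖ ^ 2 + e ^ 2) ^ (5 / 2 : ℝ))⁻¹) • cross (deriv X u) (y - X u)
        + ((‖y - X u‖ ^ 2 + e ^ 2) ^ (3 / 2 : ℝ))⁻¹ • cross (deriv X u) (b i)) :=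
    fun i => biotSavart_fderiv_apply_eq he hc₀ hX hdX hgrow y (b i)
  have hint : ∀ i, Integrable (fun u : ℝ =>
      (-3 * ⟪y - X u, b i⟫_ℝ * ((‖y - X u‖ ^ 2 + e ^ 2) ^ (5 / 2 : ℝ))⁻¹) • cross (deriv X u) (y - X u)
        + ((‖y - X u‖ ^ 2 + e ^ 2) ^ (3 / 2 : ℝ))⁻¹ • cross (deriv X u) (b i)) :=
    fun i => (stub_biotSavartDirectionalDeriv e c₀ C X he hc₀ hX hdX hgrow y (b i)).1
  simp_rw [happ]
  -- move the inner products and the sum inside the integral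
  have hinner : ∀ i, ⟪b i, ∫ u : ℝ,
      ((-3 * ⟪y - X u, b i⟫_ℝ * ((‖y - X u‖ ^ 2 + e ^ 2) ^ (5 / 2 : ℝ))⁻¹) • cross (deriv X u) (y - X u)
        + ((‖y - X u‖ ^ 2 + e ^ 2) ^ (3 / 2 : ℝ))⁻¹ • cross (deriv X u) (b i))⟫_ℝ =
      ∫ u : ℝ, ⟪b i, (-3 * ⟪y - X u, b i⟫_ℝ * ((‖y - X u‖ ^ 2 + e ^ 2) ^ (5 / 2 : ℝ))⁻¹) •
          cross (deriv X u) (y - X u) + ((‖y - X u‖ ^ 2 + e ^ 2) ^ (3 / 2 : ℝ))⁻¹ • cross (deriv X u) (b i)⟫_ℝ :=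
    fun i => (integral_inner (hint i) (b i)).symm
  simp_rw [hinner]
  rw [← integral_finsetSum _ (fun i _ => (hint i).const_inner (b i))]
  -- the integrand vanishes pointwise
  have hzero : ∀ u : ℝ, ∑ i, ⟪b i, (-3 * ⟪y - X u, b i⟫_ℝ * ((‖y - X u‖ ^ 2 + e ^ 2) ^ (5 / 2 : ℝ))⁻¹) •
        cross (deriv X u) (y - X u) + ((‖y - X u‖ ^ 2 + e ^ 2) ^ (3 / 2 : ℝ))⁻¹ • cross (deriv X u) (b i)⟫_ℝ
      = 0 := by
    intro u
    have h := sum_inner_gradIntegrand_eq_zero b (-3 * ((‖y - X u‖ ^ 2 + e ^ 2) ^ (5 / 2 : ℝ))⁻¹)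
      (((‖y - X u‖ ^ 2 + e ^ 2) ^ (3 / 2 : ℝ))⁻¹) (deriv X u) (y - X u)
    have hre : ∀ i, -3 * ⟪y - X u, b i⟫_ℝ * ((‖y - X u‖ ^ 2 + e ^ 2) ^ (5 / 2 : ℝ))⁻¹ =
        -3 * ((‖y - X u‖ ^ 2 + e ^ 2) ^ (5 / 2 : ℝ))⁻¹ * ⟪y - X u, b i⟫_ℝ := fun i => by ring
    simp_rw [hre]
    exact h
  simp_rw [hzero]
  exact integral_zero _ _

/-- **Trace of the frame-velocity gradient.** Let `v y = Σₖ cₖ • Fₖ y + ½ y − α e₃ × y` where each `Fₖ` is the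
regularised Biot–Savart field of a `C¹` filament `Xₖ` with `‖Xₖ′‖ ≤ 1` and linear growth (hypotheses of the stubs, core
`e ≠ 0`).  Then for every `x` and every orthonormal basis `b` of `ℝ³`: `Σᵢ ⟪bᵢ, (fderiv v x) bᵢ⟫ = 3/2`. [folklore] -/
theorem skeletonField_trace_eq {ι : Type*} [Fintype ι] {N : ℕ} {e c₀ α : ℝ} {C : Fin N → ℝ} {coef : Fin N → ℝ}
    {X : Fin N → ℝ → EuclideanSpace ℝ (Fin 3)} (he : e ≠ 0) (hc₀ : 0 < c₀) (hX : ∀ k, ContDiff ℝ 1 (X k))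
    (hdX : ∀ k u, ‖deriv (X k) u‖ ≤ 1) (hgrow : ∀ k u, c₀ * |u| - C k ≤ ‖X k u‖)
    (b : OrthonormalBasis ι ℝ (EuclideanSpace ℝ (Fin 3))) (x : EuclideanSpace ℝ (Fin 3)) :
    ∑ i, ⟪b i, fderiv ℝ (fun y : EuclideanSpace ℝ (Fin 3) =>
        (∑ k, coef k • ∫ u : ℝ, ((‖y - X k u‖ ^ 2 + e ^ 2) ^ (3 / 2 : ℝ))⁻¹ • cross (deriv (X k) u) (y - X k u))
          + (1 / 2 : ℝ) • y - α • cross (EuclideanSpace.single 2 1) y) x (b i)⟫_ℝ = 3 / 2 := by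
  set F : Fin N → EuclideanSpace ℝ (Fin 3) → EuclideanSpace ℝ (Fin 3) := fun k y =>
    ∫ u : ℝ, ((‖y - X k u‖ ^ 2 + e ^ 2) ^ (3 / 2 : ℝ))⁻¹ • cross (deriv (X k) u) (y - X k u) with hF
  have hdiff : ∀ k, DifferentiableAt ℝ (F k) x := fun k =>
    (stub_biotSavartDifferentiable e c₀ (C k) (X k) he hc₀ (hX k) (hdX k) (hgrow k)) x
  -- derivative of the whole field
  set Lrot : EuclideanSpace ℝ (Fin 3) →L[ℝ] EuclideanSpace ℝ (Fin 3) :=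
    crossCLM (EuclideanSpace.single (2 : Fin 3) (1 : ℝ)) with hLrot
  set M : EuclideanSpace ℝ (Fin 3) →L[ℝ] EuclideanSpace ℝ (Fin 3) :=
    (1 / 2 : ℝ) • ContinuousLinearMap.id ℝ _ - α • Lrot with hM
  have hMapp : ∀ y, M y = (1 / 2 : ℝ) • y - α • cross (EuclideanSpace.single 2 1) y := fun y => by
    simp [hM, hLrot]
  have hsum : HasFDerivAt (fun y : EuclideanSpace ℝ (Fin 3) => ∑ k, coef k • F k y)
      (∑ k, coef k • fderiv ℝ (F k) x) x :=
    HasFDerivAt.fun_sum fun k _ => ((hdiff k).hasFDerivAt).const_smul (coef k)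
  have hlin : HasFDerivAt (fun y : EuclideanSpace ℝ (Fin 3) =>
      (1 / 2 : ℝ) • y - α • cross (EuclideanSpace.single 2 1) y) M x := by
    have hf : (fun y : EuclideanSpace ℝ (Fin 3) => (1 / 2 : ℝ) • y - α • cross (EuclideanSpace.single 2 1) y) =
        fun y => M y := funext fun y => (hMapp y).symm
    rw [hf]
    exact M.hasFDerivAt
  have htot := hsum.add hlin
  have hfd : fderiv ℝ (fun y : EuclideanSpace ℝ (Fin 3) =>
        (∑ k, coef k • F k y) + ((1 / 2 : ℝ) • y - α • cross (EuclideanSpace.single 2 1) y)) x =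
      (∑ k, coef k • fderiv ℝ (F k) x) + M := htot.fderiv
  have hfun : (fun y : EuclideanSpace ℝ (Fin 3) =>
        (∑ k, coef k • ∫ u : ℝ, ((‖y - X k u‖ ^ 2 + e ^ 2) ^ (3 / 2 : ℝ))⁻¹ • cross (deriv (X k) u) (y - X k u))
          + (1 / 2 : ℝ) • y - α • cross (EuclideanSpace.single 2 1) y) =
      fun y => (∑ k, coef k • F k y) + ((1 / 2 : ℝ) • y - α • cross (EuclideanSpace.single 2 1) y) := by
    funext y; simp only [hF]; abel
  rw [hfun, hfd]
  -- evaluate the trace term by term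
  have hdiv : ∀ k, ∑ i, ⟪b i, fderiv ℝ (F k) x (b i)⟫_ℝ = 0 := fun k =>
    biotSavart_sum_inner_fderiv_eq_zero he hc₀ (hX k) (hdX k) (hgrow k) b x
  have hrot : ∀ i, ⟪b i, cross (EuclideanSpace.single (2 : Fin 3) (1 : ℝ)) (b i)⟫_ℝ = 0 := fun i => by
    rw [real_inner_comm (cross _ (b i)) (b i)]
    simp [cross, crossProduct, PiLp.inner_apply, Fin.sum_univ_three]; ring
  have hid : ∑ i, ⟪b i, b i⟫_ℝ = (3 : ℝ) := by
    have : ∀ i, ⟪b i, b i⟫_ℝ = 1 := fun i => by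
      rw [real_inner_self_eq_norm_sq, b.orthonormal.1 i, one_pow]
    simp_rw [this]
    rw [Finset.sum_const, Finset.card_univ, nsmul_eq_mul, mul_one]
    have hcard : Fintype.card ι = 3 := by
      have h := Module.finrank_eq_card_basis b.toBasis
      rw [finrank_euclideanSpace_fin] at h
      exact h.symm
    exact_mod_cast hcard
  have hterm : ∀ i, ⟪b i, ((∑ k, coef k • fderiv ℝ (F k) x) + M) (b i)⟫_ℝ =
      (∑ k, coef k * ⟪b i, fderiv ℝ (F k) x (b i)⟫_ℝ) +
        ((1 / 2 : ℝ) * ⟪b i, b i⟫_ℝ - α * ⟪b i, cross (EuclideanSpace.single (2 : Fin 3) (1 : ℝ)) (b i)⟫_ℝ) := by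
    intro i
    have happly : ((∑ k, coef k • fderiv ℝ (F k) x) + M) (b i) = (∑ k, coef k • fderiv ℝ (F k) x (b i)) + M (b i) := by
      simp
    rw [happly, hMapp, inner_add_right, inner_sum, inner_sub_right, real_inner_smul_right, real_inner_smul_right]
    congr 1
    exact Finset.sum_congr rfl fun k _ => real_inner_smul_right _ _ _
  simp_rw [hterm, hrot, mul_zero, sub_zero]
  rw [Finset.sum_add_distrib, Finset.sum_comm, ← Finset.mul_sum, hid]
  simp_rw [← Finset.mul_sum, hdiv, mul_zero, Finset.sum_const_zero]
  norm_num

/-- **Trace of the normal block.** For a linear map `A` on `ℝ³`, an orthonormal frame `(t, m, n)` and the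
eigenvector relation `A t = λ t`: `⟪A m, m⟫ + ⟪A n, n⟫ = (Σᵢ ⟪bᵢ, A bᵢ⟫ over the frame) − λ`; combined with
`skeletonField_trace_eq` this is `3/2 − λ`. [folklore] -/
theorem normalBlock_trace_eq (A : EuclideanSpace ℝ (Fin 3) →L[ℝ] EuclideanSpace ℝ (Fin 3))
    {t m n : EuclideanSpace ℝ (Fin 3)} (hon : Orthonormal ℝ ![t, m, n]) {lam τ : ℝ} (hAt : A t = lam • t)
    (htr : ∀ {ι : Type} [Fintype ι] (b : OrthonormalBasis ι ℝ (EuclideanSpace ℝ (Fin 3))),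
      ∑ i, ⟪b i, A (b i)⟫_ℝ = τ) :
    ⟪A m, m⟫_ℝ + ⟪A n, n⟫_ℝ = τ - lam := by
  have hsp : Submodule.span ℝ (Set.range ![t, m, n]) = ⊤ :=
    hon.linearIndependent.span_eq_top_of_card_eq_finrank' (by simp)
  set b : OrthonormalBasis (Fin 3) ℝ (EuclideanSpace ℝ (Fin 3)) := OrthonormalBasis.mk hon hsp.ge with hb
  have h := htr b
  have hb0 : b 0 = t := by rw [hb, OrthonormalBasis.coe_mk]; rfl
  have hb1 : b 1 = m := by rw [hb, OrthonormalBasis.coe_mk]; rfl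
  have hb2 : b 2 = n := by rw [hb, OrthonormalBasis.coe_mk]; rfl
  have ht1 : ‖t‖ = 1 := by simpa using hon.1 0
  rw [Fin.sum_univ_three, hb0, hb1, hb2, hAt, real_inner_smul_right, real_inner_self_eq_norm_sq, ht1,
    one_pow, mul_one] at h
  rw [real_inner_comm m (A m), real_inner_comm n (A n)]
  linarith

/-- **Clause 12's trace inequality is implied.** With `A`, the frame and the eigenvector relation as above, trace
`3/2` and a supercritical eigenvalue `3/2 + δ ≤ λ`, `δ > 0`: `⟪A m, m⟫ + ⟪A n, n⟫ < 0`. [folklore] -/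
theorem normalBlock_trace_neg (A : EuclideanSpace ℝ (Fin 3) →L[ℝ] EuclideanSpace ℝ (Fin 3))
    {t m n : EuclideanSpace ℝ (Fin 3)} (hon : Orthonormal ℝ ![t, m, n]) {lam δ : ℝ} (hAt : A t = lam • t)
    (htr : ∀ {ι : Type} [Fintype ι] (b : OrthonormalBasis ι ℝ (EuclideanSpace ℝ (Fin 3))),
      ∑ i, ⟪b i, A (b i)⟫_ℝ = 3 / 2)
    (hδ : 0 < δ) (hlam : 3 / 2 + δ ≤ lam) : ⟪A m, m⟫_ℝ + ⟪A n, n⟫_ℝ < 0 := by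
  rw [normalBlock_trace_eq A hon hAt htr]
  linarith

end SelectionBoxRJRung

end Summit.NavierStokesRegularity.NavierStokesRegularity.Theorems
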